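import Summits.CriticalPhenomena.PercolationContinuityZ3.Theorems.PercNearOneGluingAdditiveGluingS5Assembly
import HarnessLib

/-!
# Crux `PercNearOneGluing.AdditiveGluing` (stmt-CriticalPhenomena-4576): ADDITIVE STABILITY of the finite-graph engine —
# (S5)_η ⟹ (GEN)_η ⟹ (AG-loc)_η ⟹ an η-defective additive gluing inequality, constant 1, graded in `|A|`

Effectivity audit (lane `prim-rate`, seat audit-2; HOME/prim-rate-audit-2/AUDIT-2.md §17.4, scratch certificate of 2026-08-22 filed as a
helper), deliverable (b) «what an APPROXIMATE substitute for the finite-graph engine costs downstream» (HOME/SUBSTITUTES.md §TOL, link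
(A)→(B)).  Support file for the CLOSED crux `AdditiveGluing`; no definitions, no sorries, standard axioms; nothing here is used by the
tree's proof of the crux (`AdditiveGluing_proof`, the case `η = 0`).

If a substitute delivers the surplus-transfer inequality (S5) only up to an additive defect `η ≥ 0` in the CONDITIONAL normalisation
  (S5)_η  `μ({v ↮ T} ∩ {o ↔ v})·Sur_v(T) ≤ μ(v ↮ T)·(Sur_o(T) + η)`
(`Sur_x(T) = ∫_{x ↔ T} F(C_x) − Σ_{a ∈ T} μ(P^x_a)·m_a`, first-in-rank patterns `P^x_a` of an injective `m`-compatible rank), then for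
relay sets graded by `|A| ≤ K`:
  (GEN)_η `Σ_{a ∈ A} μ(P^o_a)·m_a ≤ ∫_{o ↔ A} F(C_o) + η` (`gen_firstRank_of_surplusTransfer_defect`, induction on `|A|`),
  (AG-loc)_η `μ(o ↔ A, o ↮ b) ≤ Σ_a μ(P^o_a)·μ(a ↮ b) + η` (`agloc_firstRank_of_gen_defect`),
  `μ(o ↔ A) − t − η ≤ μ(o ↔ b)` whenever `μ(a ↔ b) ≥ 1 − t` on `A` (`additiveGluing_card_of_agloc_firstRank_defect`);
the defect is carried with CONSTANT 1, uniformly in `n`, `|A|`, `w`, `F`.  Each proof is the tree's proof of the `η = 0` theorem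
(`AGloc.gen_firstRank_of_surplusTransfer` `…GenOfSurplusTransfer.lean:45–248`; `AGloc.additiveGluing_card_of_agloc_firstRank`,
`AGloc.agloc_firstRank_of_gen` `…OfAGloc.lean:140–183`, `:207–282`) VERBATIM with `η` threaded through the statement and ≤ 10 single-line
edits: the cancellation of the positive factor `μ(k ↮ A∖k)` and the induction on `|A|` neither amplify nor accumulate the defect in this
normalisation (in the JOINT normalisation `… ≤ μ(v ↮ T)·Sur_o(T) + η` the same cancellation would divide `η` by `μ(k ↮ A∖k)`).
Companion `…AdditiveGluingDefectStabilitySocket.lean`: all sizes, the socket and the closure over degenerate weights, down to the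
decoy-free (S5D) margin; its end result is the hypothesis `hAG` of `Quant.Defect.*` (`…NoHeavyQuantAdditiveGluingTransferDefect.lean`).
[cite: VandenbergHaggstromKahn2005, Thm. 1.3 (p. 6)] [cite: KozmaNitzan2024, Conj. 1 (p. 3)]
-/

noncomputable section

namespace Summit.CriticalPhenomena.PercolationContinuityZ3.Theorems.AGloc

namespace Defect

open MeasureTheory Set
open Literature.Probability.LatticeModels (prodBernoulli)
open Literature.Probability.Percolation Literature.Probability.Percolation.KNPreFKG

variable {n : ℕ}

/-- (S5) with additive defect `η` (conditional normalisation) for relay sets of size `≤ K` ⟹ (GEN) with the same additive defect `η`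
for relay sets of size `≤ K + 1`.  Tree proof of `AGloc.gen_firstRank_of_surplusTransfer` with `η` threaded through.
[cite: VandenbergHaggstromKahn2005, Thm. 1.3 (p. 6)] -/
theorem gen_firstRank_of_surplusTransfer_defect (K : ℕ) (η : ℝ) (hη : 0 ≤ η)
    (hS5 : ∀ (n : ℕ) (w : Sym2 (Fin n) → unitInterval) (T : Finset (Fin n)) (o v : Fin n) (F : Set (Fin n) → ℝ) (r : Fin n → ℕ),
      T.card ≤ K → v ∉ T → (∀ S S' : Set (Fin n), S ⊆ S' → F S ≤ F S') → (∀ S, 0 ≤ F S) → Set.InjOn r ↑T →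
      (∀ a ∈ T, ∀ a' ∈ T, r a < r a' →
        ∫ ω, F (openCluster ω a) ∂(prodBernoulli w) ≤ ∫ ω, F (openCluster ω a') ∂(prodBernoulli w)) →
      (prodBernoulli w).real ({ω : BondConfig (Fin n) | ∀ a ∈ T, ¬ (openGraph ω).Reachable v a} ∩ openConn o v) *
          (∫ ω in (⋃ a ∈ T, openConn v a), F (openCluster ω v) ∂(prodBernoulli w) -
            ∑ a ∈ T, (prodBernoulli w).real
                (openConn v a ∩ ⋂ a' ∈ T.filter (fun a' => r a' < r a), (openConn v a')ᶜ : Set (BondConfig (Fin n))) *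
              ∫ ω, F (openCluster ω a) ∂(prodBernoulli w)) ≤
        (prodBernoulli w).real {ω : BondConfig (Fin n) | ∀ a ∈ T, ¬ (openGraph ω).Reachable v a} *
          ((∫ ω in (⋃ a ∈ T, openConn o a), F (openCluster ω o) ∂(prodBernoulli w) -
            ∑ a ∈ T, (prodBernoulli w).real
                (openConn o a ∩ ⋂ a' ∈ T.filter (fun a' => r a' < r a), (openConn o a')ᶜ : Set (BondConfig (Fin n))) *
              ∫ ω, F (openCluster ω a) ∂(prodBernoulli w)) + η)) :
    ∀ (n : ℕ) (w : Sym2 (Fin n) → unitInterval) (A : Finset (Fin n)) (o : Fin n) (F : Set (Fin n) → ℝ) (r : Fin n → ℕ),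
      A.card ≤ K + 1 → (∀ S S' : Set (Fin n), S ⊆ S' → F S ≤ F S') → (∀ S, 0 ≤ F S) → Set.InjOn r ↑A →
      (∀ a ∈ A, ∀ a' ∈ A, r a < r a' →
        ∫ ω, F (openCluster ω a) ∂(prodBernoulli w) ≤ ∫ ω, F (openCluster ω a') ∂(prodBernoulli w)) →
      ∑ a ∈ A, (prodBernoulli w).real
            (openConn o a ∩ ⋂ a' ∈ A.filter (fun a' => r a' < r a), (openConn o a')ᶜ : Set (BondConfig (Fin n))) *
          ∫ ω, F (openCluster ω a) ∂(prodBernoulli w) ≤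
        (∫ ω in (⋃ a ∈ A, openConn o a), F (openCluster ω o) ∂(prodBernoulli w)) + η := by
  induction K with
  | zero =>
    -- `|A| ≤ 1`: empty (trivial) or a singleton (Harris)
    intro n w A o F r hA hF hF0 _ _
    classical
    rcases Nat.lt_or_ge A.card 1 with h0 | h1
    · have hA0 : A = ∅ := Finset.card_eq_zero.1 (Nat.lt_one_iff.1 h0)
      subst hA0
      simpa using hη
    · obtain ⟨a, hAa⟩ := Finset.card_eq_one.1 (le_antisymm hA h1)
      subst hAa
      have hf : ({a} : Finset (Fin n)).filter (fun a' => r a' < r a) = ∅ := by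
        rw [Finset.filter_eq_empty_iff]; intro x hx; rw [Finset.mem_singleton] at hx; subst hx; exact lt_irrefl _
      simp only [Finset.sum_singleton, hf, Finset.notMem_empty, Set.iInter_of_empty, Set.iInter_univ, Set.inter_univ,
        Finset.mem_singleton, Set.iUnion_iUnion_eq_left]
      refine le_trans ?_ (le_add_of_nonneg_right hη)
      exact setIntegral_clusterFun_ge w a F hF hF0 (openConn o a) (isUpperSet_openConn o a) |>.trans
        (le_of_eq (setIntegral_congr_fun MeasurableSet.of_discrete fun ω hω => by
          rw [openCluster_eq_of_reachable (hω : (openGraph ω).Reachable o a)]))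
  | succ K ih =>
    intro n w A o F r hA hF hF0 hr hcompat
    classical
    -- if `|A| ≤ K + 1` use the induction hypothesis directly
    by_cases hsmall : A.card ≤ K + 1
    · exact ih (fun n w T o v F r hT => hS5 n w T o v F r (hT.trans (Nat.le_succ K))) n w A o F r hsmall hF hF0 hr hcompat
    have hcard : A.card = K + 2 := by omega
    have hne : A.Nonempty := Finset.card_pos.1 (by omega)
    -- the rank-maximal relay `k` and `T = A.erase k`
    obtain ⟨k, hkA, hkmax⟩ := Finset.exists_max_image A r hne
    set T : Finset (Fin n) := A.erase k with hT
    have hTcard : T.card ≤ K + 1 := by rw [hT, Finset.card_erase_of_mem hkA]; omega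
    have hTA : ∀ a ∈ T, a ∈ A := fun a ha => Finset.mem_of_mem_erase ha
    have hkT : k ∉ T := Finset.notMem_erase k A
    have hlt : ∀ a ∈ T, r a < r k := by
      intro a ha
      rcases (hkmax a (hTA a ha)).lt_or_eq with h | h
      · exact h
      · exact absurd (hr (hTA a ha) hkA h) (Finset.ne_of_mem_erase ha)
    have hrT : Set.InjOn r ↑T := hr.mono (by intro a ha; exact hTA a ha)
    have hcompatT : ∀ a ∈ T, ∀ a' ∈ T, r a < r a' →
        ∫ ω, F (openCluster ω a) ∂(prodBernoulli w) ≤ ∫ ω, F (openCluster ω a') ∂(prodBernoulli w) :=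
      fun a ha a' ha' h => hcompat a (hTA a ha) a' (hTA a' ha') h
    -- (GEN) for `T` (induction hypothesis) and (S5) for `(o, k, T)`
    have hGenT := ih (fun n w T o v F r hT' => hS5 n w T o v F r (hT'.trans (Nat.le_succ K))) n w T o F r hTcard hF hF0 hrT hcompatT
    have hS5k := hS5 n w T o k F r hTcard hkT hF hF0 hrT hcompatT
    set μ := prodBernoulli w with hμ
    set f₀ : BondConfig (Fin n) → ℝ := fun ω => F (openCluster ω o) with hf₀
    set fk : BondConfig (Fin n) → ℝ := fun ω => F (openCluster ω k) with hfk
    set mk : ℝ := ∫ ω, fk ω ∂μ with hmk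
    have hmeas : ∀ S : Set (BondConfig (Fin n)), MeasurableSet S := fun _ => MeasurableSet.of_discrete
    have hint : ∀ (g : BondConfig (Fin n) → ℝ) (S : Set (BondConfig (Fin n))), IntegrableOn g S μ :=
      fun g S => (Integrable.of_finite).integrableOn
    have hn := fun (S : Set (BondConfig (Fin n))) => (measureReal_nonneg : 0 ≤ μ.real S)
    set UT : Set (BondConfig (Fin n)) := ⋃ a ∈ T, openConn o a with hUT
    set Ok : Set (BondConfig (Fin n)) := openConn o k with hOk
    set Dk : Set (BondConfig (Fin n)) := {ω : BondConfig (Fin n) | ∀ a ∈ T, ¬ (openGraph ω).Reachable k a} with hDk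
    set Wk : Set (BondConfig (Fin n)) := ⋃ a ∈ T, openConn k a with hWk
    set pat : Fin n → Fin n → Set (BondConfig (Fin n)) := fun x a =>
      (openConn x a ∩ ⋂ a' ∈ T.filter (fun a' => r a' < r a), (openConn x a')ᶜ : Set (BondConfig (Fin n))) with hpat
    -- patterns over `A`: for `a ∈ T` they are the `T`-patterns, for `k` it is `Ok ∩ Dk`
    have hfiltT : ∀ a ∈ T, A.filter (fun a' => r a' < r a) = T.filter (fun a' => r a' < r a) := by
      intro a ha
      rw [hT, filter_erase_of_not]
      exact fun h => lt_asymm h (hlt a ha)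
    have hfiltk : A.filter (fun a' => r a' < r k) = T := by
      ext a
      simp only [Finset.mem_filter, hT, Finset.mem_erase]
      constructor
      · rintro ⟨ha, h⟩; exact ⟨fun hak => lt_irrefl _ (hak ▸ h), ha⟩
      · rintro ⟨hak, ha⟩; exact ⟨ha, hlt a (Finset.mem_erase.2 ⟨hak, ha⟩)⟩
    have hPk : (openConn o k ∩ ⋂ a' ∈ A.filter (fun a' => r a' < r k), (openConn o a')ᶜ : Set (BondConfig (Fin n))) = Dk ∩ Ok := by
      rw [hfiltk]
      ext ω
      simp only [hDk, hOk, mem_inter_iff, mem_iInter, mem_compl_iff, openConn, mem_setOf_eq]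
      constructor
      · rintro ⟨hk', h⟩
        exact ⟨fun a ha hka => h a ha (hk'.trans hka), hk'⟩
      · rintro ⟨h, hk'⟩
        exact ⟨hk', fun a ha hoa => h a ha (hk'.symm.trans hoa)⟩
    have hsumA : ∑ a ∈ A, μ.real (openConn o a ∩ ⋂ a' ∈ A.filter (fun a' => r a' < r a), (openConn o a')ᶜ : Set (BondConfig (Fin n))) *
          ∫ ω, F (openCluster ω a) ∂μ =
        ∑ a ∈ T, μ.real (pat o a) * ∫ ω, F (openCluster ω a) ∂μ + μ.real (Dk ∩ Ok) * mk := by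
      rw [← Finset.add_sum_erase A _ hkA, hPk, add_comm]
      congr 1
      refine Finset.sum_congr rfl fun a ha => ?_
      rw [hfiltT a ha]
    -- the union over `A` splits as `UT ∪ Ok`, and `(UT ∪ Ok) \ UT = Dk ∩ Ok`
    have hUA : (⋃ a ∈ A, (openConn o a : Set (BondConfig (Fin n)))) = UT ∪ Ok := by
      ext ω
      simp only [hUT, hOk, mem_iUnion, mem_union, exists_prop, hT, Finset.mem_erase]
      constructor
      · rintro ⟨a, ha, h⟩
        by_cases hak : a = k
        · exact Or.inr (hak ▸ h)
        · exact Or.inl ⟨a, ⟨hak, ha⟩, h⟩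
      · rintro (⟨a, ⟨_, ha⟩, h⟩ | h)
        · exact ⟨a, ha, h⟩
        · exact ⟨k, hkA, h⟩
    have h0k : ∀ ω ∈ Ok, f₀ ω = fk ω := fun ω hω => by
      simp only [hf₀, hfk]; rw [openCluster_eq_of_reachable (hω : (openGraph ω).Reachable o k)]
    have hdiff : (UT ∪ Ok) \ UT = Dk ∩ Ok := by
      ext ω
      simp only [hUT, hOk, hDk, mem_sdiff, mem_union, mem_iUnion, mem_inter_iff, exists_prop, not_exists, not_and, openConn,
        mem_setOf_eq]
      constructor
      · rintro ⟨h | h, hno⟩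
        · obtain ⟨a, ha, h'⟩ := h; exact absurd h' (hno a ha)
        · exact ⟨fun a ha hka => hno a ha (h.trans hka), h⟩
      · rintro ⟨hd, hk'⟩
        exact ⟨Or.inr hk', fun a ha hoa => hd a ha (hk'.symm.trans hoa)⟩
    have hsplit : ∫ ω in UT ∪ Ok, f₀ ω ∂μ = ∫ ω in UT, f₀ ω ∂μ + ∫ ω in Dk ∩ Ok, fk ω ∂μ := by
      rw [← integral_inter_add_sdiff (hmeas UT) (hint f₀ (UT ∪ Ok)), inter_eq_right.2 subset_union_left, hdiff,
        setIntegral_congr_fun (hmeas (Dk ∩ Ok)) fun ω hω => h0k ω hω.2]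
    -- one-cluster BHK for `C(k)` given `k ↮ T`
    have hindk : ∀ ω : BondConfig (Fin n), (connFamily k o).indicator (1 : Set (Sym2 (Fin n)) → ℝ) (openEdgeCluster ω k) =
        Ok.indicator (1 : BondConfig (Fin n) → ℝ) ω := fun ω => by
      rw [congrFun (indicator_comp_openEdgeCluster (connFamily k o) k) ω, ← openConn_eq_setOf_connFamily, openConn_symm k o]
    have hprod : ∀ (S : Set (BondConfig (Fin n))) (g : BondConfig (Fin n) → ℝ),
        ∫ ω in Dk, S.indicator (1 : BondConfig (Fin n) → ℝ) ω * g ω ∂μ = ∫ ω in Dk ∩ S, g ω ∂μ := by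
      intro S g
      rw [← setIntegral_mul_indicator_one μ Dk S g]
      refine setIntegral_congr_fun (hmeas Dk) fun ω _ => ?_
      ring
    have hDset : {ω : BondConfig (Fin n) | ∀ x ∈ (↑T : Set (Fin n)), ¬ (openGraph ω).Reachable k x} = Dk := by
      ext ω; simp [hDk]
    have hBHK := BHK2006_clusterConditionalPositiveAssociation_holds (Fin n) w k (↑T : Set (Fin n))
      ((connFamily k o).indicator 1) (fun C => F {a | a = k ∨ ∃ e ∈ C, a ∈ e})
      (monotone_indicator_one_of_isUpperSet (isUpperSet_connFamily k o)) (monotone_clusterFun k F hF)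
      (by exact_mod_cast hkT)
    simp only [hDset, clusterFun_openEdgeCluster, hindk] at hBHK
    rw [setIntegral_indicator_one_eq, hprod Ok] at hBHK
    change μ.real (Dk ∩ Ok) * ∫ ω in Dk, fk ω ∂μ ≤ μ.real Dk * ∫ ω in Dk ∩ Ok, fk ω ∂μ at hBHK
    -- `Dk = Wkᶜ`
    have hDW : Dk = Wkᶜ := by
      ext ω
      simp [hDk, hWk, openConn]
    have hDint : ∫ ω in Dk, fk ω ∂μ = mk - ∫ ω in Wk, fk ω ∂μ := by
      have := integral_add_compl (hmeas Wk) (Integrable.of_finite (f := fk) (μ := μ))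
      rw [← hDW] at this
      linarith
    have hDμ : μ.real Dk = 1 - μ.real Wk := by
      have h1 : μ.real (univ : Set (BondConfig (Fin n))) = μ.real (univ ∩ Wk) + μ.real (univ \ Wk) :=
        (measureReal_inter_add_sdiff (s := univ) (h := measure_ne_top _ _) (hmeas Wk)).symm
      rw [probReal_univ, univ_inter, ← compl_eq_univ_sdiff, ← hDW] at h1
      linarith
    -- `Cov(fk, 1_{Wk}) ≤ Sur_k(T)` since `m_k` is maximal on `A`
    have hWsum : ∑ a ∈ T, μ.real (pat k a) = μ.real Wk := sum_measureReal_firstRank w T r k hrT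
    have hmle : ∀ a ∈ T, ∫ ω, F (openCluster ω a) ∂μ ≤ mk := fun a ha => hcompat a (hTA a ha) k hkA (hlt a ha)
    have hCovSur : ∫ ω in Wk, fk ω ∂μ - mk * μ.real Wk ≤
        ∫ ω in Wk, fk ω ∂μ - ∑ a ∈ T, μ.real (pat k a) * ∫ ω, F (openCluster ω a) ∂μ := by
      have : ∑ a ∈ T, μ.real (pat k a) * ∫ ω, F (openCluster ω a) ∂μ ≤ ∑ a ∈ T, μ.real (pat k a) * mk :=
        Finset.sum_le_sum fun a ha => mul_le_mul_of_nonneg_left (hmle a ha) (hn _)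
      rw [← Finset.sum_mul, hWsum] at this
      linarith
    -- assemble
    have hmkn : 0 ≤ mk := integral_nonneg fun ω => hF0 _
    have hPint : 0 ≤ ∫ ω in Dk ∩ Ok, fk ω ∂μ := setIntegral_nonneg (hmeas _) fun ω _ => hF0 _
    change μ.real (Dk ∩ Ok) * (∫ ω in Wk, fk ω ∂μ - ∑ a ∈ T, μ.real (pat k a) * ∫ ω, F (openCluster ω a) ∂μ) ≤
      μ.real Dk * ((∫ ω in UT, f₀ ω ∂μ - ∑ a ∈ T, μ.real (pat o a) * ∫ ω, F (openCluster ω a) ∂μ) + η) at hS5k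
    change ∑ a ∈ T, μ.real (pat o a) * ∫ ω, F (openCluster ω a) ∂μ ≤ (∫ ω in UT, f₀ ω ∂μ) + η at hGenT
    have hkey : μ.real Dk * (mk * μ.real (Dk ∩ Ok) - ∫ ω in Dk ∩ Ok, fk ω ∂μ) ≤
        μ.real Dk * ((∫ ω in UT, f₀ ω ∂μ - ∑ a ∈ T, μ.real (pat o a) * ∫ ω, F (openCluster ω a) ∂μ) + η) := by
      have h1 : μ.real Dk * (mk * μ.real (Dk ∩ Ok) - ∫ ω in Dk ∩ Ok, fk ω ∂μ) ≤
          μ.real (Dk ∩ Ok) * (∫ ω in Wk, fk ω ∂μ - mk * μ.real Wk) := by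
        rw [hDint, hDμ] at hBHK
        rw [hDμ]
        nlinarith [hBHK]
      have h2 := mul_le_mul_of_nonneg_left hCovSur (hn (Dk ∩ Ok))
      linarith
    have hgoal : 0 ≤ (∫ ω in UT, f₀ ω ∂μ - ∑ a ∈ T, μ.real (pat o a) * ∫ ω, F (openCluster ω a) ∂μ) + η -
        (mk * μ.real (Dk ∩ Ok) - ∫ ω in Dk ∩ Ok, fk ω ∂μ) := by
      by_cases hD0 : μ.real Dk = 0
      · have hP0 : μ.real (Dk ∩ Ok) = 0 :=
          le_antisymm (hD0 ▸ measureReal_mono inter_subset_left (measure_ne_top _ _)) (hn _)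
        rw [hP0]
        nlinarith [hGenT, hPint]
      · have hDpos : 0 < μ.real Dk := lt_of_le_of_ne (hn _) (Ne.symm hD0)
        by_contra hneg
        have := mul_neg_of_pos_of_neg hDpos (lt_of_not_ge hneg)
        nlinarith [hkey]
    rw [hsumA, hUA, hsplit]
    linarith


/-- (AG-loc) with additive defect `η` for `|A| ≤ K` ⟹ `AdditiveGluing` with slack `t + η` for `|A| ≤ K`.  Tree proof of
`AGloc.additiveGluing_card_of_agloc_firstRank` (`OfAGloc:140-183`) verbatim; statement edits only. [cite: KozmaNitzan2024, Conj. 1 (p. 3)] -/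
theorem additiveGluing_card_of_agloc_firstRank_defect (K : ℕ) (η : ℝ)
    (h : ∀ (n : ℕ) (w : Sym2 (Fin n) → unitInterval) (A : Finset (Fin n)) (o b : Fin n) (r : Fin n → ℕ),
      A.card ≤ K → Set.InjOn r ↑A →
      (∀ a ∈ A, ∀ a' ∈ A, r a < r a' →
        (prodBernoulli w).real (openConn a b) ≤ (prodBernoulli w).real (openConn a' b)) →
      (prodBernoulli w).real ((⋃ a ∈ A, openConn o a) ∩ (openConn o b)ᶜ : Set (BondConfig (Fin n))) ≤
        (∑ a ∈ A, (prodBernoulli w).real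
            (openConn o a ∩ ⋂ a' ∈ A.filter (fun a' => r a' < r a), (openConn o a')ᶜ : Set (BondConfig (Fin n))) *
          (1 - (prodBernoulli w).real (openConn a b))) + η) :
    ∀ (n : ℕ) (w : Sym2 (Fin n) → unitInterval) (A : Finset (Fin n)) (o b : Fin n) (t : ℝ), A.card ≤ K → 0 ≤ t →
      (∀ a ∈ A, 1 - t ≤ (prodBernoulli w).real (openConn a b)) →
      (prodBernoulli w).real (⋃ a ∈ A, openConn o a) - t - η ≤ (prodBernoulli w).real (openConn o b) := by
  intro n w A o b t hK ht hrel
  classical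
  set μ := prodBernoulli w with hμ
  have hmeas : ∀ S : Set (BondConfig (Fin n)), MeasurableSet S := fun S => (Set.toFinite S).measurableSet
  obtain ⟨r, hrinj, hrc⟩ := exists_rank_compat A (fun a => μ.real (openConn a b))
  have key := h n w A o b r hK hrinj hrc
  rw [← hμ] at key
  have h1 : ∑ a ∈ A, μ.real (openConn o a ∩ ⋂ a' ∈ A.filter (fun a' => r a' < r a), (openConn o a')ᶜ : Set (BondConfig (Fin n))) *
        (1 - μ.real (openConn a b)) ≤
      ∑ a ∈ A, μ.real (openConn o a ∩ ⋂ a' ∈ A.filter (fun a' => r a' < r a), (openConn o a')ᶜ : Set (BondConfig (Fin n))) * t := by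
    refine Finset.sum_le_sum fun a ha => ?_
    exact mul_le_mul_of_nonneg_left (by linarith [hrel a ha]) measureReal_nonneg
  have h2 : ∑ a ∈ A, μ.real (openConn o a ∩ ⋂ a' ∈ A.filter (fun a' => r a' < r a), (openConn o a')ᶜ : Set (BondConfig (Fin n))) * t =
      t * μ.real (⋃ a ∈ A, openConn o a) := by
    rw [← Finset.sum_mul, mul_comm, sum_measureReal_firstRank w A r o hrinj]
  have h3 : μ.real (⋃ a ∈ A, openConn o a) ≤ 1 := by
    have : μ.real (⋃ a ∈ A, openConn o a) ≤ μ.real (Set.univ : Set (BondConfig (Fin n))) :=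
      measureReal_mono (Set.subset_univ _) (measure_ne_top _ _)
    rwa [probReal_univ] at this
  have h4 : μ.real (⋃ a ∈ A, openConn o a) - μ.real (openConn o b) ≤
      μ.real ((⋃ a ∈ A, openConn o a) ∩ (openConn o b)ᶜ : Set (BondConfig (Fin n))) := by
    have hsp : μ.real (⋃ a ∈ A, openConn o a) =
        μ.real ((⋃ a ∈ A, openConn o a) ∩ openConn o b : Set (BondConfig (Fin n))) +
          μ.real ((⋃ a ∈ A, openConn o a) ∩ (openConn o b)ᶜ : Set (BondConfig (Fin n))) := by
      rw [← measureReal_inter_add_sdiff (s := ⋃ a ∈ A, (openConn o a : Set (BondConfig (Fin n)))) (h := measure_ne_top _ _)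
        (hmeas (openConn o b)), Set.sdiff_eq]
    have hm : μ.real ((⋃ a ∈ A, openConn o a) ∩ openConn o b : Set (BondConfig (Fin n))) ≤ μ.real (openConn o b) :=
      measureReal_mono Set.inter_subset_right (measure_ne_top _ _)
    linarith
  have h5 : t * μ.real (⋃ a ∈ A, openConn o a) ≤ t := by
    simpa using mul_le_mul_of_nonneg_left h3 ht
  linarith [key, h1, h2, h4, h5]

/-- (GEN) with additive defect `η` for `|A| ≤ K` ⟹ (AG-loc) with the same additive defect for `|A| ≤ K`.  Tree proof of
`AGloc.agloc_firstRank_of_gen` (`OfAGloc:207-282`) verbatim; statement edits only. [cite: KozmaNitzan2024, Conj. 1 (p. 3)] -/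
theorem agloc_firstRank_of_gen_defect (K : ℕ) (η : ℝ)
    (hgen : ∀ (n : ℕ) (w : Sym2 (Fin n) → unitInterval) (A : Finset (Fin n)) (o : Fin n) (F : Set (Fin n) → ℝ) (r : Fin n → ℕ),
      A.card ≤ K → (∀ S T : Set (Fin n), S ⊆ T → F S ≤ F T) → (∀ S, 0 ≤ F S) → Set.InjOn r ↑A →
      (∀ a ∈ A, ∀ a' ∈ A, r a < r a' →
        ∫ ω, F (openCluster ω a) ∂(prodBernoulli w) ≤ ∫ ω, F (openCluster ω a') ∂(prodBernoulli w)) →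
      ∑ a ∈ A, (prodBernoulli w).real
            (openConn o a ∩ ⋂ a' ∈ A.filter (fun a' => r a' < r a), (openConn o a')ᶜ : Set (BondConfig (Fin n))) *
          ∫ ω, F (openCluster ω a) ∂(prodBernoulli w) ≤
        (∫ ω in (⋃ a ∈ A, openConn o a), F (openCluster ω o) ∂(prodBernoulli w)) + η) :
    ∀ (n : ℕ) (w : Sym2 (Fin n) → unitInterval) (A : Finset (Fin n)) (o b : Fin n) (r : Fin n → ℕ),
      A.card ≤ K → Set.InjOn r ↑A →
      (∀ a ∈ A, ∀ a' ∈ A, r a < r a' →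
        (prodBernoulli w).real (openConn a b) ≤ (prodBernoulli w).real (openConn a' b)) →
      (prodBernoulli w).real ((⋃ a ∈ A, openConn o a) ∩ (openConn o b)ᶜ : Set (BondConfig (Fin n))) ≤
        (∑ a ∈ A, (prodBernoulli w).real
            (openConn o a ∩ ⋂ a' ∈ A.filter (fun a' => r a' < r a), (openConn o a')ᶜ : Set (BondConfig (Fin n))) *
          (1 - (prodBernoulli w).real (openConn a b))) + η := by
  intro n w A o b r hK hr hcompat
  classical
  set μ := prodBernoulli w with hμ
  have hmeas : ∀ S : Set (BondConfig (Fin n)), MeasurableSet S := fun S => (Set.toFinite S).measurableSet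
  -- the set function `F = 1{b ∈ ·}`
  set F : Set (Fin n) → ℝ := fun M => if b ∈ M then 1 else 0 with hF
  have hFmono : ∀ S T : Set (Fin n), S ⊆ T → F S ≤ F T := by
    intro S T hST
    simp only [hF]
    by_cases hS : b ∈ S
    · rw [if_pos hS, if_pos (hST hS)]
    · rw [if_neg hS]
      split_ifs <;> norm_num
  have hF0 : ∀ S, 0 ≤ F S := by
    intro S
    simp only [hF]
    split_ifs <;> norm_num
  -- `F(C(x)) = 1_{x ↔ b}`
  have hFind : ∀ x : Fin n, (fun ω : BondConfig (Fin n) => F (openCluster ω x)) =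
      (openConn x b : Set (BondConfig (Fin n))).indicator 1 := by
    intro x
    funext ω
    simp only [hF]
    by_cases hω : ω ∈ (openConn x b : Set (BondConfig (Fin n)))
    · rw [Set.indicator_of_mem hω, Pi.one_apply, if_pos (show b ∈ openCluster ω x from hω)]
    · rw [Set.indicator_of_notMem hω, if_neg (show b ∉ openCluster ω x from hω)]
  have hint : ∀ x : Fin n, ∫ ω, F (openCluster ω x) ∂μ = μ.real (openConn x b) := by
    intro x
    rw [hFind x, integral_indicator_one (hmeas _)]
  have hsetint : ∫ ω in (⋃ a ∈ A, openConn o a), F (openCluster ω o) ∂μ =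
      μ.real ((⋃ a ∈ A, openConn o a) ∩ openConn o b : Set (BondConfig (Fin n))) := by
    rw [hFind o, ← integral_indicator (hmeas _), Set.indicator_indicator, integral_indicator_one ((hmeas _).inter (hmeas _))]
  have hcompat' : ∀ a ∈ A, ∀ a' ∈ A, r a < r a' →
      ∫ ω, F (openCluster ω a) ∂μ ≤ ∫ ω, F (openCluster ω a') ∂μ := by
    intro a ha a' ha' hlt
    rw [hint a, hint a']
    exact hcompat a ha a' ha' hlt
  have key := hgen n w A o F r hK hFmono hF0 hr hcompat'
  rw [← hμ] at key
  simp only [hint] at key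
  rw [hsetint] at key
  -- `μ(U ∩ (o↔b)ᶜ) = μ(U) − μ(U ∩ (o↔b))`, `μ(U) = Σ μ(P_a)`
  have hsp : μ.real (⋃ a ∈ A, openConn o a) =
      μ.real ((⋃ a ∈ A, openConn o a) ∩ openConn o b : Set (BondConfig (Fin n))) +
        μ.real ((⋃ a ∈ A, openConn o a) ∩ (openConn o b)ᶜ : Set (BondConfig (Fin n))) := by
    rw [← measureReal_inter_add_sdiff (s := ⋃ a ∈ A, (openConn o a : Set (BondConfig (Fin n)))) (h := measure_ne_top _ _)
      (hmeas (openConn o b)), Set.sdiff_eq]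
  have hsum := sum_measureReal_firstRank w A r o hr
  rw [← hμ] at hsum
  have hexp : ∑ a ∈ A, μ.real (openConn o a ∩ ⋂ a' ∈ A.filter (fun a' => r a' < r a), (openConn o a')ᶜ : Set (BondConfig (Fin n))) *
        (1 - μ.real (openConn a b)) =
      ∑ a ∈ A, μ.real (openConn o a ∩ ⋂ a' ∈ A.filter (fun a' => r a' < r a), (openConn o a')ᶜ : Set (BondConfig (Fin n))) -
        ∑ a ∈ A, μ.real (openConn o a ∩ ⋂ a' ∈ A.filter (fun a' => r a' < r a), (openConn o a')ᶜ : Set (BondConfig (Fin n))) *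
          μ.real (openConn a b) := by
    rw [← Finset.sum_sub_distrib]
    refine Finset.sum_congr rfl fun a _ => ?_
    ring
  rw [hexp, hsum]
  linarith [key, hsp]

end Defect

end Summit.CriticalPhenomena.PercolationContinuityZ3.Theorems.AGloc

end
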